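import Summits.NavierStokesRegularity.NavierStokesRegularity.Theses.QuantisedSymmetry
import Summits.NavierStokesRegularity.NavierStokesRegularity.Theses.Blowup
import Summits.NavierStokesRegularity.NavierStokesRegularity.Theses.DssFarFieldSlaving
import Summits.NavierStokesRegularity.NavierStokesRegularity.Theorems.QuantisedSymmetryPolyhedralTruncationBridge
import Summits.NavierStokesRegularity.NavierStokesRegularity.Theorems.QuantisedSymmetryPolyhedralDssProfileExistsDominatesBlowupProfile
import Summits.NavierStokesRegularity.NavierStokesRegularity.Theorems.QuantisedSymmetryPolyhedralDssProfileExistsOfCell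
import Summits.NavierStokesRegularity.NavierStokesRegularity.Theorems.QuantisedSymmetryLiouvilleKillsProfile
import Summits.NavierStokesRegularity.NavierStokesRegularity.Theorems.DssFarFieldSlavingDssTruncationBridge
import Literature.Analysis.FluidPDE.SelfSimilarLiouville
import Literature.Analysis.FluidPDE.LocalTypeI
import HarnessLib

/-!
# Strategist census s11 — typed attempts for crux `QuantisedSymmetry.PolyhedralDssProfileExists`
  (stmt-NavierStokesRegularity-1404; unit `cstrat-stmt-NavierStokesRegularity-1404-s11`, independent census)

This scratch file backs `Cruxes/PolyhedralDssProfileExists/STRATEGY-CENSUS-s11.md`. It contains NO new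
mathematics for the tree; every `theorem` is a few lines of logic over LANDED theorems, and every `def` is a
signature recorded so that the census statements ("W is weaker", "Sub_A ∘ Sub_B ⇒ C", "S⁺ ⇒ C") are
kernel-checked rather than asserted.

Contents
0. `crux_decides_summit` — C ALONE ⇒ ¬ NavierStokesRegularity (tree theorem: `closes` ∘ proved bridge ∘
   proved ClayUniqueness). This is the summit-strength certificate of the census.
1. Weaker intermediates: `WeakerNoSymmetry` (drop G; = the `Blowup` crux stmt-0155 at one factor) with
   C ⇒ W1 ⇒ ¬S both in tree; `WeakerNoDss` (drop DSS; = ¬ PolyhedralTypeILiouville) with C ⇒ W2 in tree and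
   the MISSING bridge `NonautonomousSteeringBridge : W2 → BlowupExists` recorded as a signature.
2. Decomposition D1 (Newton–Kantorovich certificate split of the cell formulation): `NKCertification`
   (Sub_A, analytic, provable) and `CertifiedApproximateCellExists` (Sub_B, the certificate) with the
   kernel-checked join `crux_of_subs : NKCertification → CertifiedApproximateCellExists → C`.
3. Strengthening S⁺: `RigidCellExists` (a NON-DEGENERATE polyhedral cell) with `crux_of_rigidCell`.
-/

noncomputable section

set_option linter.dupNamespace false
set_option linter.unusedVariables false

namespace Summit.NavierStokesRegularity.NavierStokesRegularity.Cruxes.PolyhedralDssProfileExists.StrategistS11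

open MeasureTheory Set Function
open Literature.Analysis.FluidPDE
open Summit.NavierStokesRegularity.NavierStokesRegularity.Theses

/-- `ℝ³`. -/
abbrev E3 := EuclideanSpace ℝ (Fin 3)

/-- The group-theoretic clauses of the crux: `G` finite, proper rotations, irreducible on `ℝ³`. -/
def IsPolyhedralSector (G : Subgroup (E3 ≃ₗᵢ[ℝ] E3)) : Prop :=
  Finite G ∧ (∀ g ∈ G, LinearMap.det (g.toLinearEquiv : E3 →ₗ[ℝ] E3) = 1) ∧
    (∀ V : Submodule ℝ E3, (∀ g ∈ G, ∀ v ∈ V, g v ∈ V) → V = ⊥ ∨ V = ⊤)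

/-! ## 0. Summit-strength certificate -/

/-- **C alone decides the summit.** The other two binders of the route's deciding theorem `closes` are
tree theorems (`quantisedSymmetry_polyhedralTruncationBridge_proof`, stmt-11331, an instance of the
sector-agnostic `filamentSkeletonRss_rdssProfileTruncation_proof`; `ClayUniqueness_holds`, stmt-0153), so
`PolyhedralDssProfileExists → ¬ NavierStokesRegularity` is a theorem of the tree. -/
theorem crux_decides_summit :
    QuantisedSymmetry.PolyhedralDssProfileExists → ¬ _root_.NavierStokesRegularity :=
  fun h => QuantisedSymmetry.closes h
    _root_.Summit.NavierStokesRegularity.NavierStokesRegularity.Theorems.quantisedSymmetry_polyhedralTruncationBridge_proof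
    QuantisedSymmetry.ClayUniqueness_holds

/-! ## 1. Weaker intermediates -/

/-- **W1 (drop the symmetry group):** some Type-I `c`-DSS Liouville statement fails, i.e. a nontrivial
Type-I `c`-DSS ancient mild solution exists in NO particular sector. -/
def WeakerNoSymmetry : Prop := ∃ c : ℝ, 1 < c ∧ ¬ TypeIDSSLiouville c

/-- C ⇒ W1 (tree: `exists_not_typeIDSSLiouville_of_polyhedralDssProfileExists`). -/
theorem weakerNoSymmetry_of_crux :
    QuantisedSymmetry.PolyhedralDssProfileExists → WeakerNoSymmetry :=
  _root_.Summit.NavierStokesRegularity.NavierStokesRegularity.Theorems.PolyhedralDssProfileExists.PolyhedralCell.exists_not_typeIDSSLiouville_of_polyhedralDssProfileExists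

/-- W1 ⇒ the `Blowup` crux stmt-0155 (negated Tsai wall). -/
theorem blowupProfile_of_weakerNoSymmetry : WeakerNoSymmetry → Blowup.BlowupTypeIDssProfile := by
  rintro ⟨c, -, hL⟩ h
  exact hL (h c).1

/-- **W1 still decides the summit** (tree: the sector-agnostic truncation bridge
`dssTruncationBridge_proof`, stmt-14477, and `Blowup.closes` with the proved X5b). So dropping `G` gives a
WEAKER statement that is nevertheless summit-strength: no leverage, and it is literally route `Blowup`'s /
`DssFarFieldSlaving`'s open crux. -/
theorem weakerNoSymmetry_decides_summit : WeakerNoSymmetry → ¬ _root_.NavierStokesRegularity := by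
  intro hW
  have hP : Blowup.BlowupTypeIDssProfile := blowupProfile_of_weakerNoSymmetry hW
  exact Blowup.closes
    (_root_.Summit.NavierStokesRegularity.NavierStokesRegularity.Theorems.dssTruncationBridge_proof hP)
    QuantisedSymmetry.ClayUniqueness_holds

/-- **W2 (drop discrete self-similarity, keep the sector and Type I):** a nontrivial bounded ancient mild
solution with Type-I space–time decay, `G`-equivariant for a polyhedral `G`. -/
def WeakerNoDss : Prop :=
  ∃ G : Subgroup (E3 ≃ₗᵢ[ℝ] E3), IsPolyhedralSector G ∧
    ∃ u : ℝ → E3 → E3, IsBoundedAncientMildSolution 1 u ∧ (∀ t < 0, AEStronglyMeasurable (u t) volume) ∧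
      (∃ C₀ : ℝ, HasTypeIDecay C₀ u) ∧ (∀ g ∈ G, ∀ t x, u t (g x) = g (u t x)) ∧
      ¬ (∀ t < 0, u t =ᵐ[volume] 0)

/-- W2 is exactly the negation of the route's kill switch `PolyhedralTypeILiouville` (stmt-1405). -/
theorem weakerNoDss_iff_not_liouville :
    WeakerNoDss ↔ ¬ QuantisedSymmetry.PolyhedralTypeILiouville := by
  constructor
  · rintro ⟨G, ⟨hfin, hdet, hirr⟩, u, hb, hmeas, hdec, heqv, hnt⟩ hL
    exact hnt (hL G hfin hdet hirr u hb hmeas hdec heqv)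
  · intro h
    by_contra hno
    apply h
    intro G hfin hdet hirr u hb hmeas hdec heqv
    by_contra hnt
    exact hno ⟨G, ⟨hfin, hdet, hirr⟩, u, hb, hmeas, hdec, heqv, hnt⟩

/-- C ⇒ W2 (tree: the proved glue `LiouvilleKillsProfile`, stmt-1408: time-shift + DSS spreading). -/
theorem weakerNoDss_of_crux : QuantisedSymmetry.PolyhedralDssProfileExists → WeakerNoDss := by
  intro hX
  rw [weakerNoDss_iff_not_liouville]
  intro hL
  exact _root_.Summit.NavierStokesRegularity.NavierStokesRegularity.Theorems.quantisedSymmetry_liouvilleKillsProfile_proof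
    hL hX

/-- **The bridge W2 would need** to feed `closes` (NOT in tree; the DSS bridge's period-map / Floquet
structure is replaced by a NONAUTONOMOUS pseudo-stable steering along the backward orbit in similarity
variables; plausibly provable by the same quasi-compactness mechanism on the α-limit hull, size L–XL).
Recorded as a signature only: even granted, W2 ⇒ BlowupExists ⇒ ¬S, so W2 is again a blow-up EXISTENCE
claim (Albritton–Barker 2019 Thm 1.1: Type-I ancient mild ⇔ local Type-I singularity). -/
def NonautonomousSteeringBridge : Prop := WeakerNoDss → Blowup.BlowupExists

/-- Granted the bridge, W2 decides the summit like C does. -/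
theorem weakerNoDss_decides_summit_of_bridge (hB : NonautonomousSteeringBridge) :
    WeakerNoDss → ¬ _root_.NavierStokesRegularity :=
  fun hW => Blowup.closes (hB hW) QuantisedSymmetry.ClayUniqueness_holds

/-- **W3 (drop sector AND self-similarity):** the Literature's registered OPEN statement
`NontrivialMildAncientTypeIExists` (Albritton–Barker 2019 Thm 1.1, second bullet; no `_holds`, and by
`AlbrittonBarkerTypeICharacterization` — both directions landed — equivalent to the existence of a local
Type-I singular point). The weakest statement of the family in the tree; still a singularity-existence claim. -/
def WeakestNoSectorNoDss : Prop := NontrivialMildAncientTypeIExists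

/-! ## 2. Decomposition D1 — Newton–Kantorovich certificate split of the cell formulation

The crux is (tree: `stub_profileOfPolyhedralCell`) the existence of ONE polyhedral cell: a jointly
continuous bounded weakly-solenoidal `G`-equivariant field `v` on the model period `[-1, -c⁻²] × ℝ³`,
Oseen-mild, closing up under the zoom. Equivalently `v` is a fixed point of the CELL MAP
`Φ_c(v)(t) = e^{(t+1)Δ} 𝒵_c v(-c⁻²) − B_{-1}(v,v)(t)` on the closed period (at `t = -1` this is the junction,
since `heatFlow φ 0 = φ` and `B_{-1}(v,v)(-1) = 0`). D1 splits "∃ nontrivial fixed point" into an ANALYTIC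
Newton–Kantorovich lemma (Sub_A) and a CERTIFICATE (Sub_B). -/

/-- The model period `[-1, -c⁻²]`. -/
def period (c : ℝ) : Set ℝ := Set.Icc (-1 : ℝ) (-(c ^ 2)⁻¹)

/-- Zoom-out by the factor `c` (inverse DSS zoom on a slice): `(𝒵_c w)(x) = c⁻¹ • w (c⁻¹ • x)`, so that
`v(-1) = 𝒵_c (v(-c⁻²)) ↔ ∀ x, v(-c⁻²) x = c • v(-1) (c • x)`. -/
def zoomOut (c : ℝ) (w : E3 → E3) : E3 → E3 := fun x => c⁻¹ • w (c⁻¹ • x)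

/-- The cell map `Φ_c` on space–time fields over one period. -/
def cellMap (c : ℝ) (v : ℝ → E3 → E3) : ℝ → E3 → E3 :=
  fun t x => heatFlow (zoomOut c (v (-(c ^ 2)⁻¹))) (t + 1) x - oseenDuhamel 1 (-1) v v t x

/-- Its linearisation at `v₀` in the direction `h`. -/
def cellMapDeriv (c : ℝ) (v₀ h : ℝ → E3 → E3) : ℝ → E3 → E3 :=
  fun t x => heatFlow (zoomOut c (h (-(c ^ 2)⁻¹))) (t + 1) x
    - oseenDuhamel 1 (-1) v₀ h t x - oseenDuhamel 1 (-1) h v₀ t x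

/-- The weighted class `X_G(c)`: jointly continuous on the closed period, `(1+‖x‖)`-weighted bounded,
weakly divergence-free and `G`-equivariant slice by slice. (A real vector space; complete for the weighted
sup norm.) -/
def InCellClass (G : Subgroup (E3 ≃ₗᵢ[ℝ] E3)) (c : ℝ) (v : ℝ → E3 → E3) : Prop :=
  ContinuousOn (Function.uncurry v) (period c ×ˢ Set.univ) ∧
    (∃ M : ℝ, ∀ t ∈ period c, ∀ x, (1 + ‖x‖) * ‖v t x‖ ≤ M) ∧
    (∀ t ∈ period c, IsWeaklyDivFree (v t)) ∧
    (∀ g ∈ G, ∀ t ∈ period c, ∀ x, v t (g x) = g (v t x))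

/-- `‖v‖_w ≤ M` for the weighted sup norm `‖v‖_w = sup_{period × ℝ³} (1+‖x‖) ‖v t x‖`. -/
def WNormLe (c : ℝ) (v : ℝ → E3 → E3) (M : ℝ) : Prop :=
  ∀ t ∈ period c, ∀ x, (1 + ‖x‖) * ‖v t x‖ ≤ M

/-- An explicit bilinear constant `β` for the Oseen–Duhamel term on `X_G(c)` (what a certificate must
supply: `‖B_{-1}(u,w)‖_w ≤ β ‖u‖_w ‖w‖_w`, with `B_{-1}(u,w) ∈ X_G(c)`). -/
def BilinearBound (G : Subgroup (E3 ≃ₗᵢ[ℝ] E3)) (c β : ℝ) : Prop :=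
  ∀ (u w : ℝ → E3 → E3) (Mu Mw : ℝ), InCellClass G c u → InCellClass G c w →
    WNormLe c u Mu → WNormLe c w Mw →
      InCellClass G c (oseenDuhamel 1 (-1) u w) ∧ WNormLe c (oseenDuhamel 1 (-1) u w) (β * Mu * Mw)

/-- **A certified approximate non-degenerate polyhedral cell** `(v₀, δ, K)`: `v₀ ∈ X_G(c)` with residual
`‖Φ_c v₀ − v₀‖_w ≤ δ`, the linearisation `I − DΦ_c(v₀)` boundedly invertible on `X_G(c)` with bound `K`
(unique solvability with the bound), the Newton–Kantorovich inequality `4K²βδ < 1`, and a nontriviality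
margin at the datum slice. -/
def CertifiedApproximateCell (G : Subgroup (E3 ≃ₗᵢ[ℝ] E3)) (c β : ℝ) (v₀ : ℝ → E3 → E3)
    (δ K : ℝ) : Prop :=
  InCellClass G c v₀ ∧ InCellClass G c (cellMap c v₀) ∧
    WNormLe c (fun t x => cellMap c v₀ t x - v₀ t x) δ ∧
    (∀ (h : ℝ → E3 → E3) (Mh : ℝ), InCellClass G c h → WNormLe c h Mh →
      ∃ k : ℝ → E3 → E3, InCellClass G c k ∧ WNormLe c k (K * Mh) ∧
        ∀ t ∈ period c, ∀ x, k t x - cellMapDeriv c v₀ k t x = h t x) ∧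
    (∀ k : ℝ → E3 → E3, InCellClass G c k →
      (∀ t ∈ period c, ∀ x, k t x - cellMapDeriv c v₀ k t x = 0) → ∀ t ∈ period c, ∀ x, k t x = 0) ∧
    4 * K ^ 2 * β * δ < 1 ∧ (∃ x : E3, 2 * K * δ < (1 + ‖x‖) * ‖v₀ (-1) x‖)

/-- The body of the line's ∃-stub / hypothesis of `stub_profileOfPolyhedralCell`: a genuine `G`-cell. -/
def IsCell (G : Subgroup (E3 ≃ₗᵢ[ℝ] E3)) (c : ℝ) (v : ℝ → E3 → E3) : Prop :=
  ContinuousOn (Function.uncurry v) (Set.Icc (-1 : ℝ) (-(c ^ 2)⁻¹) ×ˢ Set.univ) ∧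
    (∃ M : ℝ, ∀ t ∈ Set.Icc (-1 : ℝ) (-(c ^ 2)⁻¹), ∀ x, ‖v t x‖ ≤ M) ∧
    (∀ t ∈ Set.Icc (-1 : ℝ) (-(c ^ 2)⁻¹), IsWeaklyDivFree (v t)) ∧
    (∀ s t : ℝ, -1 ≤ s → s < t → t ≤ -(c ^ 2)⁻¹ → ∀ x,
      v t x = heatFlow (v s) (t - s) x - oseenDuhamel 1 s v v t x) ∧
    (∀ x, v (-(c ^ 2)⁻¹) x = c • v (-1) (c • x)) ∧
    (∀ g ∈ G, ∀ t ∈ Set.Icc (-1 : ℝ) (-(c ^ 2)⁻¹), ∀ x, v t (g x) = g (v t x))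

/-- **Sub_A — Newton–Kantorovich certification lemma (analytic, provable, size L).** A certified
approximate non-degenerate cell has a genuine nontrivial cell with `L⁴` datum within `2Kδ` of it.
Content: quadratic NK in the Banach space `X_G(c)`; a fixed point of `Φ_c` in `X_G(c)` is Oseen-mild from
`-1` with the junction built in, Oseen-mild between all pairs by the semigroup identity for bounded
continuous fields, `v(-1) ∈ L⁴` from the weight `(1+‖x‖)⁻¹ ∈ L⁴(ℝ³)`, and `v(-1) ≢ 0` from the margin and
continuity. No Navier–Stokes-specific difficulty. -/
def NKCertification : Prop :=
  ∀ (G : Subgroup (E3 ≃ₗᵢ[ℝ] E3)) (c : ℝ), 1 < c → ∀ (β : ℝ), BilinearBound G c β →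
    ∀ (v₀ : ℝ → E3 → E3) (δ K : ℝ), CertifiedApproximateCell G c β v₀ δ K →
      ∃ v : ℝ → E3 → E3, IsCell G c v ∧ MemLp (v (-1)) 4 volume ∧ ¬ (v (-1) =ᵐ[volume] 0)

/-- **Sub_B — the certificate (carries the whole existence content of the crux).** -/
def CertifiedApproximateCellExists : Prop :=
  ∃ G : Subgroup (E3 ≃ₗᵢ[ℝ] E3), IsPolyhedralSector G ∧ ∃ c : ℝ, 1 < c ∧ ∃ β : ℝ, BilinearBound G c β ∧
    ∃ (v₀ : ℝ → E3 → E3) (δ K : ℝ), CertifiedApproximateCell G c β v₀ δ K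

/-- **The join of D1 is kernel-checked:** Sub_A → Sub_B → C, through the landed reduction
`stub_profileOfPolyhedralCell` (one polyhedral cell with nontrivial `L⁴` datum gives the crux). -/
theorem crux_of_subs (hA : NKCertification) (hB : CertifiedApproximateCellExists) :
    QuantisedSymmetry.PolyhedralDssProfileExists := by
  obtain ⟨G, ⟨hfin, hdet, hirr⟩, c, hc, β, hβ, v₀, δ, K, hcert⟩ := hB
  obtain ⟨v, hcell, hL4, hnt⟩ := hA G c hc β hβ v₀ δ K hcert
  exact _root_.Summit.NavierStokesRegularity.NavierStokesRegularity.Theorems.PolyhedralDssProfileExists.PolyhedralCell.stub_profileOfPolyhedralCell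
    ⟨G, hfin, hdet, hirr, c, hc, v, hcell, hL4, hnt⟩

/-! ## 3. Strengthening S⁺ — a rigid (non-degenerate) cell -/

/-- **S⁺: a NON-DEGENERATE polyhedral cell exists** — a genuine cell whose linearised cell map
`I − DΦ_c(v)` has trivial kernel on `X_G(c)` (the DSS orbit is an isolated, transversal fixed point of the
renormalisation map in its sector). Strictly stronger than the crux; the added rigidity is what continuation
/ NK / implicit-function arguments consume, but it presupposes the object. -/
def RigidCellExists : Prop :=
  ∃ G : Subgroup (E3 ≃ₗᵢ[ℝ] E3), IsPolyhedralSector G ∧ ∃ c : ℝ, 1 < c ∧ ∃ v : ℝ → E3 → E3,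
    IsCell G c v ∧ MemLp (v (-1)) 4 volume ∧ ¬ (v (-1) =ᵐ[volume] 0) ∧
    (∀ k : ℝ → E3 → E3, InCellClass G c k →
      (∀ t ∈ period c, ∀ x, k t x - cellMapDeriv c v k t x = 0) → ∀ t ∈ period c, ∀ x, k t x = 0)

/-- S⁺ ⇒ C (forget the rigidity). -/
theorem crux_of_rigidCell (h : RigidCellExists) : QuantisedSymmetry.PolyhedralDssProfileExists := by
  obtain ⟨G, ⟨hfin, hdet, hirr⟩, c, hc, v, hcell, hL4, hnt, -⟩ := h
  exact _root_.Summit.NavierStokesRegularity.NavierStokesRegularity.Theorems.PolyhedralDssProfileExists.PolyhedralCell.stub_profileOfPolyhedralCell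
    ⟨G, hfin, hdet, hirr, c, hc, v, hcell, hL4, hnt⟩

end Summit.NavierStokesRegularity.NavierStokesRegularity.Cruxes.PolyhedralDssProfileExists.StrategistS11

end
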